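import Mathlib.Geometry.Manifold.MFDeriv.NormedSpace
import Mathlib.Analysis.SpecialFunctions.Pow.NNReal
import Literature.Geometry.Lorentzian.LorentzianMetric
import Literature.Geometry.Lorentzian.LeviCivita
import Literature.Geometry.Lorentzian.Causality
import Literature.Geometry.Lorentzian.Geodesic
import Literature.Geometry.Lorentzian.NullInfinity
import Literature.Geometry.Lorentzian.CauchyDevelopment
import HarnessLib

/-!
# Bounded scale-free geometry of a Cauchy development; blow-up at infinity

Definition request `defn-HasBoundedScaleFreeGeometry` (route
`route-FinalStateConjecture-ConcentrationCannotWait`, card *concentration-cannot-wait*, D1): the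
typed hinge of the foreseen split `RegularCompleteDisperses ⇐ NoBlowUpAtInfinity →
BoundedRegularDisperses`.

For a Cauchy development `𝒟 = (M, g, τ, ι, ν)` of an initial data set on `X`
(`Literature.Geometry.Lorentzian.CauchyDevelopment`) we formalise:

* `LorentzianMetric.observerInner g x T` — the **Euclidean form of an observer**: for a unit
  timelike vector `T` at `x`, the positive definite form `h_T := g + 2 T♭ ⊗ T♭`,
  `h_T(v, w) = g(v, w) + 2 g(T, v) g(T, w)`; in a `g`-orthonormal frame `e₀ = T, e₁, …, e_d` it is
  the identity matrix (`observerInner_self_pos`: positive definite, proved from the Lorentzian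
  signature axiom `pos_of_orthogonal`).
* `LorentzianMetric.IsCurvatureBoundedAt g x T C` — the Riemann tensor `R = g.riemann` obeys
  `|g(R(X,Y)Z, W)| ≤ C ‖X‖_T ‖Y‖_T ‖Z‖_T ‖W‖_T` for all tangent vectors at `x`, `‖v‖_T := √h_T(v,v)`;
  `LorentzianMetric.curvatureSize g x T` — the least such `C ≥ 0` (an `sInf`, Mathlib's operator-norm
  pattern), the **`T`-size of the curvature at `x`**, and `curvatureScale := curvatureSize^{-1/2}`
  in `ℝ≥0∞` (`= ⊤` at flat points), the **curvature scale** (card D1: `ℓ := |Riem|^{-1/2}`).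
  In dimension `4` and in a `T`-adapted orthonormal frame the electric–magnetic parts
  `E = ii_T(R)`, `H = ii_T(⋆R)` of Christodoulou–Klainerman determine `R` when `Ric = 0`
  (CK 1993, §7.2, p. 143, (7.2.1)) and `∑_{abcd} R_{abcd}² = 8 (|E|² + |H|²)`; this is the
  point-wise norm `|R|² = |E|² + |H|²` "measured in terms of the electric-magnetic decomposition of
  `R` with respect to the future unit normal `T` of the leaves" in which Anderson states curvature
  blow-up and his scale-invariant curvature assumption (Anderson, CMP 222 (2001), Thm. 0.1, (0.7),
  (0.11), §5). The size defined here is the `h_T`-operator norm of `R`, equivalent to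
  `(|E|² + |H|²)^{1/2}` up to a dimensional constant, so "bounded"/"unbounded" below do not depend
  on which of these positive definite, observer-dependent norms is used. It is defined without frames or the Hodge dual, in every
  dimension, and it is positive definite in `R` (it vanishes iff `R_x = 0`).
* `LorentzianMetric.IsLapseBoundedObserverOn g τ S t T N₀ N₁` — the **geometric tie of the
  observer field** (the design point of the request): on the set `S`, `T` is the future unit normal
  of the level sets of a smooth time function `t` (`T ⊥_g ker dt`, `dt(T) > 0`) whose **lapse**
  `N := 1 / dt(T) = (−g(∇t, ∇t))^{-1/2}` (CK 1993, Introduction, (1.0.1): "the lapse function of the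
  foliation") satisfies `0 < N₀ ≤ N ≤ N₁` — the uniformity under which curvature is measured
  relative to a time foliation in Christodoulou–Klainerman (maximal foliation, `E`, `H` relative to
  its unit normal `T`, CK 1993, p. 4 and §7.2) and in the breakdown / `L²`-curvature criteria of
  Klainerman–Rodnianski(–Szeftel) (curvature and `k`, `∇ log n` measured in the frame of the unit
  normal to a foliation with lapse `n` bounded above and below, Klainerman–Rodnianski 2010,
  Thm. 1.1, A2, `N₀⁻¹ ≤ n ≤ N₀`) and in Anderson 2001 (CMC foliation, Thm. 0.1, (0.7), (0.11)).
* `CauchyDevelopment.HasBoundedScaleFreeGeometry 𝒟` — **bounded scale-free geometry to the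
  future of the data**: there are a lapse-bounded observer field `(t, T, N₀, N₁)` on `J⁺(ι X)` and a
  constant `C` with `IsCurvatureBoundedAt g p (T p) C` at every `p ∈ J⁺(ι X)`; i.e.
  `sup_{J⁺(ιX)} |Riem|_T < ∞`. "Scale-free" refers to the invariance of this proposition under the
  scaling `(g, t) ↦ (λ² g, λ t)`, `λ > 0` (then `T ↦ λ⁻¹ T`, `N ↦ N`, `|Riem|_T ↦ λ⁻² |Riem|_T`,
  `C ↦ λ⁻² C`): finiteness of the supremum, not its value, is asserted (planner's correction of the
  request, evidence note 2026-08-15: "'bounded' = finite sup of `|Riem|_T` on `J⁺(ι X)` for a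
  geometrically tied observer field `T` (lapse-bounded time function / maximal foliation /
  rapidity-capped geodesic observers), NOT the `t⁻²` decay"). Of the three admissible ties we take
  the first, the only one that is a *condition* rather than an existence theorem (maximal
  foliations) or generically singular (geodesic observer congruences form caustics); the
  observer-dependence that remains — `inf_T |Riem|_T = 0` pointwise for null curvature types, so an
  untied `∃ T` would under-detect radiation-type concentration — is the frame-dependence design
  problem recorded with the request, and the tie is exposed as the separate predicate
  `IsLapseBoundedObserverOn` so that layer-2 items can strengthen it (e.g. add `tr k = 0`) without
  touching this file.
* `CauchyDevelopment.BlowsUpAtInfinity 𝒟` — the species the route intends to prove empty (card D1,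
  corrected by the route: horizonless := future causally geodesically complete): complete future
  null infinity (sojourn form, verbatim the body of `Summit.FinalStateConjecture.HasCompleteNullInfinity`)
  ∧ no future-incomplete null or timelike maximal geodesic ∧ `¬ HasBoundedScaleFreeGeometry`. This is
  the vacuum, foliation-relative analogue of Luk–Oh's notion for spherically symmetric
  Einstein–scalar fields ("we say that a solution blows up at infinity if some scale-invariant
  spacetime norms are infinite", arXiv:1402.2984, §3.2, Def. 3.12, for future causally geodesically
  complete solutions; dichotomy Thm. 3.14), whose exclusion is open even there (Luk–Oh, Rem. 3.13;
  Kehle–Unger arXiv:2402.10190, Rem. 1.4).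

API (all proved): symmetry/positivity of `observerInner`; `curvatureSize_nonneg`,
`IsCurvatureBoundedAt.curvatureSize_le`, `IsCurvatureBoundedAt.mono`, the flat case
(`isCurvatureBoundedAt_zero_of_riemann_eq_zero`, `curvatureSize_eq_zero_of_riemann_eq_zero`,
`curvatureScale_eq_top_of_riemann_eq_zero`); lapse bounds `N₀ ≤ lapse ≤ N₁` and `dt(T) > 0` for a
lapse-bounded observer; `HasBoundedScaleFreeGeometry.curvatureSize_le` (uniform bound of the size on
`J⁺(ι X)`), `hasBoundedScaleFreeGeometry_of_riemann_eq_zero` (a development flat on `J⁺(ι X)`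
carrying any lapse-bounded observer field has bounded scale-free geometry), and
`BlowsUpAtInfinity.not_hasBoundedScaleFreeGeometry`. The Minkowski instance
(`t = x⁰`, `T = ∂₀`, `N ≡ 1`, `C = 0`) is proved in `BoundedScaleFreeGeometryMinkowski`.

## Mathlib

Mathlib (at the pin) has `mvfderiv` (differential of a real function on a manifold), `Real.sInf`,
`ENNReal.rpow`; no Lorentzian geometry. Everything Lorentzian is from `Literature.Geometry.Lorentzian`
(`LorentzianMetric`, `TimeOrientation.IsFutureDirected`, `PseudoRiemannianMetric.riemann`,
`LorentzianMetric.causalFuture`, `HasCompleteFutureNullInfinity`,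
`IsFutureNullGeodesicallyIncomplete`, `CauchyDevelopment`).

## References

* D. Christodoulou, S. Klainerman, *The Global Nonlinear Stability of the Minkowski Space*,
  Princeton Math. Series 41, PUP 1993: Introduction, (1.0.1) (time function, lapse
  `φ = (−⟨Dt, Dt⟩)^{-1/2}`, canonical form `−φ² dt² + g_{ij} dxⁱ dxʲ`), p. 4 (`E`, `H` of `R` w.r.t.
  the unit normal `T` of the `t`-foliation); §7.2, p. 143, (7.2.1) (electric–magnetic decomposition;
  it determines `W` for `X` non-null).
* S. Klainerman, I. Rodnianski, *On the breakdown criterion in general relativity*, J. Amer. Math.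
  Soc. 23 (2010), 345–382, arXiv:0801.1709: Thm. 1.1 (Main Theorem: continuation of a CMC-foliated
  vacuum development while `sup (‖k‖_∞ + ‖∇ log n‖_∞) < ∞`), assumption A2 (bounded deformation
  tensor of the future unit normal `T`, components w.r.t. an orthonormal frame `e₀ = T, e₁, e₂, e₃`)
  and the uniform lapse bounds `N₀⁻¹ ≤ n ≤ N₀` (§4); S. Klainerman, I. Rodnianski, J. Szeftel,
  *The bounded `L²` curvature conjecture*, Invent. Math. 202 (2015), 91–216 (curvature flux and
  `L²` norms relative to the unit normal of a maximal foliation).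
* M. T. Anderson, *On long-time evolution in general relativity and geometrization of
  3-manifolds*, Comm. Math. Phys. 222 (2001), 533–567, arXiv:gr-qc/0006042: Thm. 0.1 and (0.7)
  (`|R|² = |E|² + |H|²` w.r.t. the future unit normal `T` of a CMC foliation; `|R|(xᵢ) → ∞`),
  (0.11) and §5, (5.2) (scale-invariant curvature bounds `|R| ≤ C/t²` relative to a CMC foliation).
* J. Luk, S.-J. Oh, *Quantitative decay rates for dispersive solutions to the Einstein–scalar field
  system in spherical symmetry*, Anal. PDE 8 (2015), 1603–1674, arXiv:1402.2984, §3.2, Def. 3.12,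
  Rem. 3.13, Thm. 3.14.
* C. Kehle, R. Unger, arXiv:2402.10190, Rem. 1.4 (ruling out blow-up at infinity is open).
-/

noncomputable section

open Manifold Bundle Set Topology
open scoped ContDiff

universe u

namespace Literature.Geometry.Lorentzian

variable {E : Type*} [NormedAddCommGroup E] [NormedSpace ℝ E] {H : Type*} [TopologicalSpace H]
  {I : ModelWithCorners ℝ E H} {n : ℕ∞ω} {M : Type*} [TopologicalSpace M] [ChartedSpace H M]
  [IsManifold I ∞ M]

/-! ### The lapse of a time function along an observer field -/

variable (I) in
/-- The **lapse** `N(p) := 1 / dt_p(T_p)` of the time function `t` along the field `T`: for `T` the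
future unit normal of the level sets of `t` this is `(−g(∇t, ∇t))^{-1/2}`, "the lapse function of the
foliation" (Christodoulou–Klainerman 1993, Introduction, (1.0.1): `ds² = −φ² dt² + g_{ij} dxⁱ dxʲ`).
[cite: ChristodoulouKlainerman1993PMS41, Introduction, (1.0.1)] -/
def lapse (t : M → ℝ) (T : Π y : M, TangentSpace I y) (p : M) : ℝ :=
  (mvfderiv I t p (T p))⁻¹

namespace LorentzianMetric

variable (g : LorentzianMetric I n M)

/-! ### The Euclidean form of an observer -/

/-- The **Euclidean form of the observer `T` at `x`**: `h_T(v, w) := g(v, w) + 2 g(T, v) g(T, w)`,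
i.e. `h_T = g + 2 T♭ ⊗ T♭`. For a unit timelike `T` (`g(T, T) = −1`) this is the positive definite
form which is the identity matrix in every `g`-orthonormal frame `e₀ = T, e₁, …` (it flips the sign
of `g` on the line `ℝ T` and agrees with `g` on `T^⊥`); it is the standard device for measuring
space-time tensors "in the frame of the observer `T`" (Christodoulou–Klainerman 1993, p. 4 and
§7.2: components relative to `e₀ = T` and an orthonormal frame tangent to the foliation).
[cite: ChristodoulouKlainerman1993PMS41, §7.2, p. 143] -/
def observerInner (x : M) (T v w : TangentSpace I x) : ℝ :=
  g.val x v w + 2 * g.val x T v * g.val x T w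

/-- The **`T`-norm** `‖v‖_T := √ h_T(v, v)` of a tangent vector relative to the observer `T` at `x`
(Euclidean length in a `T`-adapted orthonormal frame). Christodoulou–Klainerman 1993, §7.2.
[cite: ChristodoulouKlainerman1993PMS41, §7.2, p. 143] -/
def observerNorm (x : M) (T v : TangentSpace I x) : ℝ :=
  √(g.observerInner x T v v)

variable {g} {x : M}

/-- Unfolding lemma for `observerInner`. [folklore] -/
lemma observerInner_apply (T v w : TangentSpace I x) :
    g.observerInner x T v w = g.val x v w + 2 * g.val x T v * g.val x T w := rfl

/-- The Euclidean form of an observer is symmetric. [folklore] -/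
lemma observerInner_symm (T v w : TangentSpace I x) :
    g.observerInner x T v w = g.observerInner x T w v := by
  simp only [observerInner_apply, g.symm x v w]
  ring

/-- A unit timelike observer has unit `T`-length: `h_T(T, T) = 1`. [folklore] -/
lemma observerInner_self_observer {T : TangentSpace I x} (hT : g.val x T T = -1) :
    g.observerInner x T T T = 1 := by
  simp only [observerInner_apply, hT]
  norm_num

/-- On the `g`-orthogonal complement of the observer, `h_T` is `g`. [folklore] -/
lemma observerInner_of_orthogonal {T v : TangentSpace I x} (hv : g.val x T v = 0)
    (w : TangentSpace I x) : g.observerInner x T v w = g.val x v w := by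
  simp [observerInner_apply, hv]

/-- **`h_T` is positive definite** for a unit timelike observer `T`: `h_T(v, v) > 0` for `v ≠ 0`.
Write `v = w − a T` with `a = g(T, v)`, `w ⊥ T`; then `h_T(v, v) = g(w, w) + a²` and `g(w, w) > 0`
for `w ≠ 0` by the Lorentzian signature (`pos_of_orthogonal`). O'Neill 1983, Ch. 5, Lemma 5.26.
[cite: ONeill1983, Ch. 5, Lemma 5.26] -/
theorem observerInner_self_pos {T : TangentSpace I x} (hT : g.val x T T = -1)
    {v : TangentSpace I x} (hv : v ≠ 0) : 0 < g.observerInner x T v v := by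
  -- `w := v + g(T, v) T` is the `g`-orthogonal projection of `v` to `T^⊥`
  have hTw : g.val x T (v + g.val x T v • T) = 0 := by
    simp only [map_add, map_smul, smul_eq_mul, hT]
    ring
  have key : g.observerInner x T v v =
      g.val x (v + g.val x T v • T) (v + g.val x T v • T) + (g.val x T v) ^ 2 := by
    have h1 : g.val x v T = g.val x T v := g.symm x v T
    simp only [observerInner_apply, map_add, map_smul, add_apply, FunLike.coe_smul,
      Pi.smul_apply, smul_eq_mul, hT, h1]
    ring
  rw [key]
  by_cases hw0 : v + g.val x T v • T = 0
  · have ha0 : g.val x T v ≠ 0 := by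
      intro ha
      apply hv
      rwa [ha, zero_smul, add_zero] at hw0
    rw [hw0, map_zero, zero_add]
    positivity
  · have hpos : 0 < g.val x (v + g.val x T v • T) (v + g.val x T v • T) :=
      g.pos_of_orthogonal x T _ (by rw [hT]; norm_num) hTw hw0
    positivity

/-- `h_T(v, v) ≥ 0` for a unit timelike observer. O'Neill 1983, Ch. 5, Lemma 5.26.
[cite: ONeill1983, Ch. 5, Lemma 5.26] -/
theorem observerInner_self_nonneg {T : TangentSpace I x} (hT : g.val x T T = -1)
    (v : TangentSpace I x) : 0 ≤ g.observerInner x T v v := by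
  by_cases hv : v = 0
  · subst hv
    simp [observerInner_apply]
  · exact (observerInner_self_pos hT hv).le

/-- `h_T(v, v) = 0` iff `v = 0`, for a unit timelike observer. O'Neill 1983, Ch. 5, Lemma 5.26.
[cite: ONeill1983, Ch. 5, Lemma 5.26] -/
theorem observerInner_self_eq_zero_iff {T : TangentSpace I x} (hT : g.val x T T = -1)
    {v : TangentSpace I x} : g.observerInner x T v v = 0 ↔ v = 0 := by
  refine ⟨fun h ↦ ?_, fun h ↦ by subst h; simp [observerInner_apply]⟩
  by_contra hv
  exact (observerInner_self_pos hT hv).ne' h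

/-- The `T`-norm is nonnegative. [folklore] -/
lemma observerNorm_nonneg (T v : TangentSpace I x) : 0 ≤ g.observerNorm x T v :=
  Real.sqrt_nonneg _

/-- A unit timelike observer has `T`-norm `1`. [folklore] -/
lemma observerNorm_observer {T : TangentSpace I x} (hT : g.val x T T = -1) :
    g.observerNorm x T T = 1 := by
  simp [observerNorm, observerInner_self_observer hT]

/-! ### The observer-relative size of the curvature -/

section Curvature

variable (g) [g.HasLeviCivita]

/-- **The curvature is bounded by `C` in the frame of the observer `T` at `x`**: the Riemann tensor
`R = g.riemann` (curvature of the Levi-Civita connection) satisfies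
`|g(R(X, Y) Z, W)| ≤ C ‖X‖_T ‖Y‖_T ‖Z‖_T ‖W‖_T` for all `X, Y, Z, W ∈ T_x M`. In a `T`-adapted
orthonormal frame (`h_T`-orthonormal = `g`-orthonormal with `e₀ = T`) this bounds every component
`R_{abcd}`, in dimension `4` and vacuum equivalently the electric–magnetic parts `E = ii_T(R)`,
`H = ii_T(⋆R)` (Christodoulou–Klainerman 1993, §7.2, (7.2.1)), i.e. Anderson's point-wise norm
`|R|² = |E|² + |H|²` relative to `T` (CMP 222 (2001), (0.7)), up to a dimensional constant.
[cite: ChristodoulouKlainerman1993PMS41, §7.2, p. 143] [cite: Anderson2001, Thm. 0.1, (0.7)] -/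
def IsCurvatureBoundedAt (x : M) (T : TangentSpace I x) (C : ℝ) : Prop :=
  ∀ X Y Z W : TangentSpace I x,
    |g.val x (g.riemann x X Y Z) W| ≤
      C * (g.observerNorm x T X * g.observerNorm x T Y * g.observerNorm x T Z *
        g.observerNorm x T W)

/-- The **`T`-size of the curvature at `x`**, `|Riem|_T(x)`: the least `C ≥ 0` with
`IsCurvatureBoundedAt g x T C` (the `h_T`-operator norm of the quadrilinear form
`g(R(·,·)·,·)`, defined as an infimum like Mathlib's `ContinuousMultilinearMap.opNorm`; junk value
`0` if no bound exists, which does not happen on finite-dimensional tangent spaces). Equivalent up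
to a dimensional constant to the Euclidean frame norm `(∑ R_{abcd}²)^{1/2}`, in `4`-dimensional
vacuum `= (8(|E|² + |H|²))^{1/2}` (Anderson 2001, (0.7): `|R|² = |E|² + |H|²`).
[cite: Anderson2001, Thm. 0.1, (0.7)] [cite: ChristodoulouKlainerman1993PMS41, §7.2, p. 143] -/
def curvatureSize (x : M) (T : TangentSpace I x) : ℝ :=
  sInf {C : ℝ | 0 ≤ C ∧ g.IsCurvatureBoundedAt x T C}

/-- The **curvature scale** `ℓ_T(x) := |Riem|_T(x)^{-1/2} ∈ (0, ∞]` at `x` relative to the observer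
`T` (the length at which the curvature measured by `T` is of unit size; `⊤` at points where the
size vanishes). Card *concentration-cannot-wait*, D1 (`ℓ := |Riem|^{-1/2}`); compare the
scale-invariant norms of Luk–Oh, arXiv:1402.2984, §3.2. [cite: LukOh2015, §3.2, Def. 3.12] -/
def curvatureScale (x : M) (T : TangentSpace I x) : ENNReal :=
  ENNReal.ofReal (g.curvatureSize x T) ^ (-(1 : ℝ) / 2)

variable {g}

/-- A curvature bound can only be weakened. [folklore] -/
lemma IsCurvatureBoundedAt.mono {T : TangentSpace I x} {C C' : ℝ}
    (h : g.IsCurvatureBoundedAt x T C) (hCC' : C ≤ C') : g.IsCurvatureBoundedAt x T C' :=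
  fun X Y Z W ↦ (h X Y Z W).trans <| mul_le_mul_of_nonneg_right hCC' <|
    mul_nonneg (mul_nonneg (mul_nonneg (observerNorm_nonneg _ _) (observerNorm_nonneg _ _))
      (observerNorm_nonneg _ _)) (observerNorm_nonneg _ _)

/-- Where the Riemann tensor vanishes the curvature is bounded by `0` in every frame. [folklore] -/
lemma isCurvatureBoundedAt_zero_of_riemann_eq_zero (hR : g.riemann x = 0)
    (T : TangentSpace I x) : g.IsCurvatureBoundedAt x T 0 := by
  intro X Y Z W
  simp [hR]

/-- The `T`-size of the curvature is nonnegative. [folklore] -/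
lemma curvatureSize_nonneg (x : M) (T : TangentSpace I x) : 0 ≤ g.curvatureSize x T :=
  Real.sInf_nonneg fun _ h ↦ h.1

/-- Any admissible bound dominates the size: `IsCurvatureBoundedAt g x T C`, `0 ≤ C` gives
`curvatureSize g x T ≤ C`. [folklore] -/
theorem IsCurvatureBoundedAt.curvatureSize_le {T : TangentSpace I x} {C : ℝ}
    (h : g.IsCurvatureBoundedAt x T C) (hC : 0 ≤ C) : g.curvatureSize x T ≤ C :=
  csInf_le ⟨0, fun _ h' ↦ h'.1⟩ ⟨hC, h⟩

/-- At a flat point the curvature size vanishes. [folklore] -/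
theorem curvatureSize_eq_zero_of_riemann_eq_zero (hR : g.riemann x = 0) (T : TangentSpace I x) :
    g.curvatureSize x T = 0 :=
  le_antisymm ((isCurvatureBoundedAt_zero_of_riemann_eq_zero hR T).curvatureSize_le le_rfl)
    (curvatureSize_nonneg x T)

/-- At a flat point the curvature scale is infinite. [folklore] -/
theorem curvatureScale_eq_top_of_riemann_eq_zero (hR : g.riemann x = 0) (T : TangentSpace I x) :
    g.curvatureScale x T = ⊤ := by
  rw [curvatureScale, curvatureSize_eq_zero_of_riemann_eq_zero hR, ENNReal.ofReal_zero]
  exact ENNReal.zero_rpow_of_neg (by norm_num)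

end Curvature

/-! ### Lapse-bounded observer fields (the geometric tie) -/

variable (τ : TimeOrientation g)

variable (g) in
/-- **Lapse-bounded observer field on `S`.** The data: a smooth function `t : M → ℝ`, a field of
tangent vectors `T`, constants `N₀, N₁`. The conditions, at every point `p ∈ S`: `T_p` is a unit
timelike (`g(T, T) = −1`) future-directed vector, `g`-orthogonal to `ker dt_p` — so that the level
set of `t` through `p` is spacelike with future unit normal `T_p` — and the lapse
`N(p) = 1 / dt_p(T_p)` lies in `[N₀, N₁]` with `0 < N₀ ≤ N₁` (encoded as
`N₁⁻¹ ≤ dt_p(T_p) ≤ N₀⁻¹`). This is a time foliation of `S` with lapse bounded above and below,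
the uniformity under which curvature is measured relative to the unit normal of a foliation in
Christodoulou–Klainerman 1993 (Introduction, (1.0.1) and p. 4; there moreover `tr k = 0` and
`φ → 1` at infinity) and in the breakdown criterion of Klainerman–Rodnianski, JAMS 23 (2010),
Thm. 1.1 with the uniform lapse bounds `N₀⁻¹ ≤ n ≤ N₀` of its §4. It is the "geometrically tied
observer field" of the definition request (first of the three admissible ties listed there).
[cite: ChristodoulouKlainerman1993PMS41, Introduction, (1.0.1)]
[cite: KlainermanRodnianski2010Breakdown, Thm. 1.1 and §4] -/
structure IsLapseBoundedObserverOn (S : Set M) (t : M → ℝ) (T : Π y : M, TangentSpace I y)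
    (N₀ N₁ : ℝ) : Prop where
  /-- The lower lapse bound is positive. -/
  lapse_pos : 0 < N₀
  /-- The lapse bounds are ordered. -/
  lapse_le : N₀ ≤ N₁
  /-- The time function is smooth. -/
  contMDiff : ContMDiff I 𝓘(ℝ, ℝ) ∞ t
  /-- `T` is unit timelike on `S`. -/
  val_self : ∀ p ∈ S, g.val p (T p) (T p) = -1
  /-- `T` is future-directed on `S`. -/
  isFutureDirected : ∀ p ∈ S, τ.IsFutureDirected (T p)
  /-- `T` is `g`-normal to the level sets of `t` on `S`. -/
  normal : ∀ p ∈ S, ∀ v : TangentSpace I p, mvfderiv I t p v = 0 → g.val p (T p) v = 0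
  /-- The lapse `1 / dt(T)` lies in `[N₀, N₁]` on `S`. -/
  lapse_mem : ∀ p ∈ S, N₁⁻¹ ≤ mvfderiv I t p (T p) ∧ mvfderiv I t p (T p) ≤ N₀⁻¹

namespace IsLapseBoundedObserverOn

variable {τ} {S : Set M} {t : M → ℝ} {T : Π y : M, TangentSpace I y} {N₀ N₁ : ℝ}

/-- The upper lapse bound is positive. [folklore] -/
lemma lapse_pos' (h : g.IsLapseBoundedObserverOn τ S t T N₀ N₁) : 0 < N₁ :=
  h.lapse_pos.trans_le h.lapse_le

/-- The time function increases along the observer: `dt(T) > 0` on `S`. [folklore] -/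
lemma mvfderiv_pos (h : g.IsLapseBoundedObserverOn τ S t T N₀ N₁) {p : M} (hp : p ∈ S) :
    0 < mvfderiv I t p (T p) :=
  (inv_pos.mpr h.lapse_pos').trans_le (h.lapse_mem p hp).1

/-- The lapse is at least `N₀` on `S`. Christodoulou–Klainerman 1993, (1.0.1).
[cite: ChristodoulouKlainerman1993PMS41, Introduction, (1.0.1)] -/
theorem le_lapse (h : g.IsLapseBoundedObserverOn τ S t T N₀ N₁) {p : M} (hp : p ∈ S) :
    N₀ ≤ lapse I t T p := by
  rw [lapse, le_inv_comm₀ h.lapse_pos (h.mvfderiv_pos hp)]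
  exact (h.lapse_mem p hp).2

/-- The lapse is at most `N₁` on `S`. Christodoulou–Klainerman 1993, (1.0.1).
[cite: ChristodoulouKlainerman1993PMS41, Introduction, (1.0.1)] -/
theorem lapse_le' (h : g.IsLapseBoundedObserverOn τ S t T N₀ N₁) {p : M} (hp : p ∈ S) :
    lapse I t T p ≤ N₁ := by
  rw [lapse, inv_le_comm₀ (h.mvfderiv_pos hp) h.lapse_pos']
  exact (h.lapse_mem p hp).1

/-- The observer is timelike on `S`. [folklore] -/
lemma isTimelike (h : g.IsLapseBoundedObserverOn τ S t T N₀ N₁) {p : M} (hp : p ∈ S) :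
    g.IsTimelike (T p) := by
  rw [isTimelike_iff, h.val_self p hp]
  norm_num

/-- Restriction of a lapse-bounded observer field to a subset. [folklore] -/
lemma mono (h : g.IsLapseBoundedObserverOn τ S t T N₀ N₁) {S' : Set M} (hS' : S' ⊆ S) :
    g.IsLapseBoundedObserverOn τ S' t T N₀ N₁ where
  lapse_pos := h.lapse_pos
  lapse_le := h.lapse_le
  contMDiff := h.contMDiff
  val_self p hp := h.val_self p (hS' hp)
  isFutureDirected p hp := h.isFutureDirected p (hS' hp)
  normal p hp := h.normal p (hS' hp)
  lapse_mem p hp := h.lapse_mem p (hS' hp)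

end IsLapseBoundedObserverOn

end LorentzianMetric

/-! ### Bounded scale-free geometry and blow-up at infinity of a Cauchy development -/

namespace CauchyDevelopment

variable {d : ℕ} {X : Type u} [TopologicalSpace X] [ChartedSpace (EuclideanSpace ℝ (Fin d)) X]
  [IsManifold (𝓡 d) ∞ X] [ConnectedSpace X] {D : InitialDataSet (𝓡 d) X}

/-- The **causal future of the data hypersurface**, `J⁺(ι X) ⊆ M`. Hawking–Ellis 1973, §6.5.
[cite: HawkingEllis1973, §6.5] -/
abbrev dataCausalFuture (𝒟 : CauchyDevelopment D) : Set 𝒟.carrier :=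
  𝒟.metric.causalFuture 𝒟.timeOrientation (range 𝒟.embed)

/-- **Bounded scale-free geometry to the future of the data** (definition request
`defn-HasBoundedScaleFreeGeometry`, hinge of route ConcentrationCannotWait). For the Cauchy
development `𝒟 = (M, g, τ, ι, ν)`, granted the Levi-Civita connection of `g`: there exist a
lapse-bounded observer field `(t, T, N₀, N₁)` on `J⁺(ι X)` (`IsLapseBoundedObserverOn`: `T` the
future unit normal of the level sets of the smooth time function `t`, lapse `1/dt(T) ∈ [N₀, N₁]`,
`0 < N₀ ≤ N₁`) and a constant `C` such that at every `p ∈ J⁺(ι X)` the Riemann tensor is bounded by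
`C` in the frame of `T_p` (`IsCurvatureBoundedAt`: `|g(R(X,Y)Z,W)| ≤ C ∏ ‖·‖_T`), i.e.
`sup_{J⁺(ι X)} |Riem|_T ≤ C < ∞` for the positive definite observer norm of the curvature (in `4`-d
vacuum: of `(E, H)`, Christodoulou–Klainerman 1993, §7.2; Anderson 2001, (0.7), whose Thm. 0.1
phrases curvature blow-up as `|R|_T(xᵢ) → ∞` for the unit normal `T` of a foliation). Invariant under
`(g, t) ↦ (λ²g, λt)` (with `C ↦ λ⁻² C`), whence "scale-free" (compare Anderson 2001, (0.11), §5);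
its negation along a regular complete development is `BlowsUpAtInfinity`.
[cite: Anderson2001, Thm. 0.1, (0.7), (0.11)] [cite: ChristodoulouKlainerman1993PMS41, §7.2, p. 143]
[cite: LukOh2015, §3.2, Def. 3.12] -/
def HasBoundedScaleFreeGeometry (𝒟 : CauchyDevelopment D) : Prop :=
  ∀ [𝒟.metric.HasLeviCivita],
    ∃ (t : 𝒟.carrier → ℝ) (T : Π p : 𝒟.carrier, TangentSpace (𝓡 (d + 1)) p) (N₀ N₁ C : ℝ),
      𝒟.metric.IsLapseBoundedObserverOn 𝒟.timeOrientation 𝒟.dataCausalFuture t T N₀ N₁ ∧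
        ∀ p ∈ 𝒟.dataCausalFuture, 𝒟.metric.IsCurvatureBoundedAt p (T p) C

/-- **Blow-up at infinity** (card *concentration-cannot-wait* D1, with the route's correction
horizonless := future causally geodesically complete): the Cauchy development has complete future
null infinity in the sojourn sense (verbatim the body of
`Summit.FinalStateConjecture.HasCompleteNullInfinity`), no future-directed null or timelike maximal
geodesic is future-incomplete, and yet its scale-free geometry is unbounded
(`¬ HasBoundedScaleFreeGeometry`). The vacuum analogue of Luk–Oh's "solution which blows up at
infinity" — a future causally geodesically complete solution some of whose scale-invariant
space-time norms are infinite (arXiv:1402.2984, §3.2, Def. 3.12; dichotomy Thm. 3.14; existence or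
non-existence not known, Rem. 3.13). [cite: LukOh2015, §3.2, Def. 3.12] -/
def BlowsUpAtInfinity (𝒟 : CauchyDevelopment D) : Prop :=
  (∀ [𝒟.metric.HasLeviCivita],
      𝒟.metric.HasCompleteFutureNullInfinity 𝒟.timeOrientation 𝒟.embed 𝒟.normal) ∧
    (∀ [𝒟.metric.HasLeviCivita],
      ¬ 𝒟.metric.IsFutureNullGeodesicallyIncomplete 𝒟.timeOrientation ∧
        ¬ 𝒟.metric.IsFutureTimelikeGeodesicallyIncomplete 𝒟.timeOrientation) ∧
    ¬ 𝒟.HasBoundedScaleFreeGeometry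

/-- The **curvature size** `|Riem|_T(p)` of the development at `p` relative to a field of observers
`T` (`LorentzianMetric.curvatureSize` of `g`). Christodoulou–Klainerman 1993, §7.2.
[cite: ChristodoulouKlainerman1993PMS41, §7.2, p. 143] -/
abbrev curvatureSize (𝒟 : CauchyDevelopment D) [𝒟.metric.HasLeviCivita]
    (T : Π p : 𝒟.carrier, TangentSpace (𝓡 (d + 1)) p) (p : 𝒟.carrier) : ℝ :=
  𝒟.metric.curvatureSize p (T p)

/-- The **curvature scale** `ℓ_T(p) = |Riem|_T(p)^{-1/2} ∈ (0, ∞]` of the development at `p`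
relative to a field of observers `T` (card D1). [cite: LukOh2015, §3.2, Def. 3.12] -/
abbrev curvatureScale (𝒟 : CauchyDevelopment D) [𝒟.metric.HasLeviCivita]
    (T : Π p : 𝒟.carrier, TangentSpace (𝓡 (d + 1)) p) (p : 𝒟.carrier) : ENNReal :=
  𝒟.metric.curvatureScale p (T p)

variable {𝒟 : CauchyDevelopment D}

/-- Bounded scale-free geometry gives a uniform bound of the curvature size on `J⁺(ι X)` relative
to the witnessing observer field. [folklore] -/
theorem HasBoundedScaleFreeGeometry.exists_curvatureSize_le (h : 𝒟.HasBoundedScaleFreeGeometry)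
    [𝒟.metric.HasLeviCivita] :
    ∃ (t : 𝒟.carrier → ℝ) (T : Π p : 𝒟.carrier, TangentSpace (𝓡 (d + 1)) p) (N₀ N₁ C : ℝ),
      𝒟.metric.IsLapseBoundedObserverOn 𝒟.timeOrientation 𝒟.dataCausalFuture t T N₀ N₁ ∧
        ∀ p ∈ 𝒟.dataCausalFuture, 𝒟.curvatureSize T p ≤ C := by
  obtain ⟨t, T, N₀, N₁, C, hobs, hC⟩ := h
  refine ⟨t, T, N₀, N₁, max C 0, hobs, fun p hp ↦ ?_⟩
  exact ((hC p hp).mono (le_max_left C 0)).curvatureSize_le (le_max_right C 0)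

/-- **The flat case.** A Cauchy development whose Riemann tensor vanishes on `J⁺(ι X)` and which
carries some lapse-bounded observer field there has bounded scale-free geometry (`C = 0`).
[folklore] -/
theorem hasBoundedScaleFreeGeometry_of_riemann_eq_zero
    (hobs : ∀ [𝒟.metric.HasLeviCivita],
      ∃ (t : 𝒟.carrier → ℝ) (T : Π p : 𝒟.carrier, TangentSpace (𝓡 (d + 1)) p) (N₀ N₁ : ℝ),
        𝒟.metric.IsLapseBoundedObserverOn 𝒟.timeOrientation 𝒟.dataCausalFuture t T N₀ N₁)
    (hflat : ∀ [𝒟.metric.HasLeviCivita], ∀ p ∈ 𝒟.dataCausalFuture, 𝒟.metric.riemann p = 0) :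
    𝒟.HasBoundedScaleFreeGeometry := by
  intro _
  obtain ⟨t, T, N₀, N₁, h⟩ := hobs
  exact ⟨t, T, N₀, N₁, 0, h, fun p hp ↦
    LorentzianMetric.isCurvatureBoundedAt_zero_of_riemann_eq_zero (hflat p hp) (T p)⟩

/-- A development which blows up at infinity does not have bounded scale-free geometry.
[folklore] -/
theorem BlowsUpAtInfinity.not_hasBoundedScaleFreeGeometry (h : 𝒟.BlowsUpAtInfinity) :
    ¬ 𝒟.HasBoundedScaleFreeGeometry :=
  h.2.2

/-- A development with bounded scale-free geometry does not blow up at infinity. [folklore] -/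
theorem HasBoundedScaleFreeGeometry.not_blowsUpAtInfinity (h : 𝒟.HasBoundedScaleFreeGeometry) :
    ¬ 𝒟.BlowsUpAtInfinity :=
  fun hb ↦ hb.2.2 h

end CauchyDevelopment

end Literature.Geometry.Lorentzian

end
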